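import Literature.NumberTheory.EllipticCurves.Rank1Residual.Typed.VisibilityCertificate
import Literature.NumberTheory.EllipticCurves.Rank1Residual.X9NoEntry
import Summits.BirchSwinnertonDyer.Rank1Residual.Partition.Rows
import HarnessLib

/-!
# Row C16 at `p = 3` (scoreboard row D3), rank zero with `ord₃ #Ш_an = 2`, WITHOUT Beilinson–Flach:
# `BSD(E,3)` from a VISIBLE `Ш(E)[3]` (a `3`-congruent curve of rank `≥ 2`) + Wuthrich's upper bound
# + Cassels–Tate (cell `bsd-litref`, paper sub-dir `yz26`, seat `bsd-litref-yz26-pv`; LADDER-BSD H0/H1 · W7)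

HONEST FRAMING (programme `BSD-LIT2PART-PROGRAMME-v1.md` §HONESTY, verbatim): «no tranche here
proves BSD; ARM L moves the LITERAL column of an r ≤ 1 census into the
kernel-proved-modulo-named-print column; ARM P changes what «named print» is worth.» Theorems only;
no definition, no named fact beyond the tree's EXISTING ones, taken as hypotheses. PER PAIR
(certificate-shaped inputs: a congruent curve, a Galois-equivariant torsion isomorphism, two
independent points, local `3`-torsion data); NOT a class theorem; nothing is booked here.

The 179 rank-`0` classes of row D3 all have `9 ∣ #Ш_an` (177 with `ord₃ #Ш_an = 2`), so neither the
Kato leading-term road (`X10KatoCertificateRowC16.lean`, needs `3 ∤ #Ш_an`) nor Wuthrich's lever L1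
reaches them; the Greenberg–Vatsal congruence road (`X10CongruenceTransfer.lean`) reaches the 31 with a
rank-`0` partner in Cremona's table. THIS file records, for row C16 BY NAME, the road the
supersingular cell (x10b) uses on X6/X7: the tree's KERNEL visibility theorem
(`WeierstrassCurve.exists_sha_ne_zero_of_congr_of_rank`, `CongruenceVisibilityLocalFactors.lean`:
Cremona–Mazur 2000 §3 / Agashe–Stein 2002 Thm. 3.1 as a Selmer-structure count, PROVED in the tree,
no Jacobian and no multiplicity one) packaged with Wuthrich 2014 Prop. 21 and Cassels–Tate in
`Literature.…Rank1Residual.Typed.bsdp_of_wuthrich_of_congr_of_surj` (`Typed/VisibilityCertificate.lean`).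
On row C16 its class-level side conditions are automatic: `3` is a good prime (`¬` additive) and
`ρ̄_{E,3}` is onto (`surj(3) ∨ ram(3)` with `irr(3)`). Per pair it then needs: `r_an(E) = 0`,
`#Ш_an(E) = q` with `ord₃ q ≤ 2`, a curve `E'` with a `Γ_ℚ`-equivariant `E'[3] ≃ E[3]`,
`rank E'(ℚ) ≥ 2`, a finite set `S` of primes off which both curves are good and which contains `3`,
and `E'(ℚ_v)[3] = 0` for `v ∈ S`. Census of the seat (pub/bsd-litref/yz26/D3-R0-VISIBILITY-DOOR.md):
68 of the 179 classes have such a partner at the SAME conductor with every input certified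
(congruence by Sturm's bound and by an explicit octic-field isomorphism; two Cremona generators
independent modulo `3E'(ℚ)` at two auxiliary primes; local `3`-torsion by `3`-adic/`ℓ`-adic root
counts).

References: [CremonaMazur2000] §3, Table 1; [AgasheStein2002] Thm. 3.1, Lemma 3.6; [Wuthrich2014]
Prop. 21 (p. 400); [SilvermanAEC2009] Thm. X.4.14 (Cassels–Tate); [Miller2011LMS] Def. 1.1.
-/

set_option autoImplicit false

noncomputable section

open scoped Classical

open WeierstrassCurve Literature.NumberTheory.EllipticCurves
  Literature.NumberTheory.EllipticCurves.Rank1Residual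
  Literature.NumberTheory.EllipticCurves.Rank1Residual.Typed
  Literature.NumberTheory.EllipticCurves.Wuthrich2014
  Literature.NumberTheory.GaloisRepresentations
open NumberField IsDedekindDomain

namespace Summit.BirchSwinnertonDyer.Rank1Residual

/-- **Row C16 ∩ {r_an = 0} at `p = 3` with `ord₃ #Ш_an ≤ 2`: `BSD(E,3)` from a `3`-CONGRUENT curve of
rank `≥ 2` with no local `3`-torsion on `S`** (visible `(ℤ/3)² ⊂ Ш(E)`, Cassels–Tate, Wuthrich's
Prop. 21 upper bound). Class hypothesis `RowC16 W 3` (good ordinary `3`, `E[3]` irreducible,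
`surj(3) ∨ ram(3)`): it supplies "not additive at `3`" and `surj(3)` (`surj_of_irr_of_ram` in the
(ram) case), the two side conditions of `Typed.bsdp_of_wuthrich_of_congr_of_surj`. Named facts (all
PUBLISHED, all already in the tree): Cassels–Tate (`hCT`), Wuthrich 2014 Prop. 21 (`hW`), GZK
(`hGZK`), modularity (`hmod`). Per pair: `hr0`, `hq`/`hv` (the lane's `#Ш_an`), the partner `W'` with
the equivariant `θ : E'[3] ≃ E[3]`, `hrank : 2 ≤ rank E'(ℚ)`, the set `S` with `hS`, and `hloc`.
PER PAIR; NOT a class theorem. [cite: CremonaMazur2000, §3 and Table 1]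
[cite: AgasheStein2002, Thm. 3.1] [cite: Wuthrich2014, Prop. 21 (p. 400)]
[cite: SilvermanAEC2009, Thm. X.4.14] -/
theorem RowC16.bsdp_three_rankZero_of_congr_rankTwo
    (hCT : exists_casselsTate_pairing (K := ℚ)) (hW : sha_dvd_analyticSha)
    (hGZK : rank_eq_analyticRank_of_analyticRank_le_one) (hmod : hasEntireLFunction_rat)
    (W : WeierstrassCurve ℚ) [W.IsElliptic] [W.IsGloballyMinimal]
    (h : RowC16 W 3) (hr0 : W.analyticRank = 0)
    {q : ℚ} (hq : shaAn W = (q : ℂ)) (hv : padicValRat 3 q ≤ 2)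
    (W' : WeierstrassCurve ℚ) [W'.IsElliptic]
    (θ : geomTorsion W' ((3 : ℕ) : ℤ) ≃+ geomTorsion W ((3 : ℕ) : ℤ))
    (hθ : ∀ (σ : Field.absoluteGaloisGroup ℚ) (P : geomTorsion W' ((3 : ℕ) : ℤ)), θ (σ • P) = σ • θ P)
    (hrank : 2 ≤ W'.mordellWeilRank) (S : Finset (HeightOneSpectrum (𝓞 ℚ)))
    (hS : ∀ v : HeightOneSpectrum (𝓞 ℚ), v ∉ S →
      W.HasGoodReductionAt v ∧ W'.HasGoodReductionAt v ∧ ((3 : ℕ) : 𝓞 ℚ) ∉ v.asIdeal)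
    (hloc : ∀ v ∈ S, Nat.card (nsmulAddMonoidHom (3 : ℕ) :
      (W'.baseChange (v.adicCompletion ℚ)).toAffine.Point →+ _).ker = 1) :
    BSDp W 3 := by
  obtain ⟨-, hgo, hirr, hsr⟩ := h
  have hsurj : Surj W 3 := by
    rcases hsr with hs3 | hram
    · exact hs3
    · exact surj_of_irr_of_ram W 3 hirr hram
  exact bsdp_of_wuthrich_of_congr_of_surj W 3 hCT hW hGZK hmod (by decide) hr0
    (WeierstrassCurve.HasGoodReduction.not_hasAdditiveReduction _ hgo.1) hsurj hq hv W' θ hθ hrank S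
    hS hloc

end Summit.BirchSwinnertonDyer.Rank1Residual

end
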